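import Literature.NumberTheory.NumberFields.CyclicCubicField1339AClassGroup
import Literature.NumberTheory.EllipticCurves.TwoDescentLocalImageMod8
import Literature.NumberTheory.EllipticCurves.TwoDescentParity
import HarnessLib

/-!
# The cyclic cubic field of conductor `1339` (`2` split): the norm-`1` `2`-descent of `480a1`

Fifth file on `K = K' = ℚ(θ)`, `θ³ + θ² - 446θ + 248 = 0` (`𝓞 K = ℤ ⊕ ℤθ ⊕ ℤw`,
`w = (θ² + 9θ + 4)/14`; units `u₁, u₂`; class group of exponent `3`). Here `2 = 𝔭₁𝔭₂𝔭₃` SPLITS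
COMPLETELY (`θ ≡ 6, 28, 29 (mod 32)` `2`-adically), so the `2`-adic information lives in three copies
of `ℚ₂` and is read off through the three reductions `ρ₁, ρ₂, ρ₃ : 𝓞 K → ℤ/8 = 𝓞 K/𝔭ᵢ³`
(`(θ, w) ↦ (6, 1), (4, 0), (5, 7)`) with the generic bookkeeping of
`Literature/NumberTheory/EllipticCurves/TwoDescentLocalImageMod8.lean` (`Mod8Prime.LocQ`,
`Mod8Prime.localImage`). We prove (`normDescent`): for every `K`-point `(x, y)`, `y ≠ 0`, of
`E : y² = x(x + 2)(x - 3)` (`480a1`) with `N_{K/ℚ}(x)`, `N_{K/ℚ}(x + 2) ∈ ℚˣ²`, both `x` and `x + 2`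
are squares in `K` — the input `NormDescent(K)` of
`Literature.Barriers.BirchSwinnertonDyer.DokchitserDokchitser2011.rank_480a1_F3_of_normDescent`, and
(`normDescent_of_root`) the same over any cubic extension of `ℚ` generated by a root of `f'`.

## Proof

* `𝔭ᵢ³ = (πᵢ)` with `π₁ = 1 - 3θ + w`, `π₂ = σπ₁ = 88 + 2θ - 3w`, `π₃ = σ²π₁ = -19 + θ + 2w`,
  `π₁π₂π₃ = 8`, `N(πᵢ) = 8`; the `2`-adic classes `(ord, residue mod 8)` of `u₁, u₂, π₁, π₂, π₃` at
  `𝔭₁, 𝔭₂, 𝔭₃` are certified by `Mod8Prime.locQ_of_mul_eq` (e.g. `π₁ · (π₂π₃) = 2³ · 1` at `𝔭₁`).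
* For a point, the classes `(nᵢ, rᵢ)` of `x` at `𝔭ᵢ` satisfy `n₁ + n₂ + n₃ ≡ 0 (mod 2)`
  (`N(x) = x · σx · σ²x` is a rational square and `ρ₁ ∘ σ = ρ₃`, `ρ₃ ∘ σ = ρ₂`), so
  `x/γ`, `γ = π₁^p π₂^q π₃^{p+q}` (`p ≡ n₁, q ≡ n₂`), has even valuation at `𝔭₁, 𝔭₂, 𝔭₃`; at `(3)`,
  `(5)` (inert) by `N(x) = □`, and at all other primes by the parity lemma. As the class group has
  odd order, `x = ±u₁^i u₂^j γ A²`, and `N(x) > 0` kills the sign; likewise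
  `x + 2 = u₁^{i'} u₂^{j'} γ' B²`, and `x + 2` is totally positive.
* `Mod8Prime.localImage` at `𝔭₁, 𝔭₂, 𝔭₃` puts the pair of classes of
  `(u₁^i u₂^j γ, u₁^{i'} u₂^{j'} γ')` in `W³`; together with the sign condition a `decide` over the
  `2⁸` exponent patterns leaves only the trivial one (`final_check`): `x = A²`, `x + 2 = B²`.

Everything is proved (kernel-checked computations by `decide`); no named facts are introduced.

## References

* T. Dokchitser, V. Dokchitser, *A note on the Mordell–Weil rank modulo `n`*, J. Number Theory 131
  (2011) 1833–1839: proof of Thm. 2 ("2-descent shows that rk E/F₃ = 1 (e.g. using Magma, over all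
  minimal non-trivial subfields of Fₙ)"). [DokchitserDokchitser2011RankModN]
* J. H. Silverman, *The Arithmetic of Elliptic Curves*, 2nd ed., GTM 106 (2009): Prop. X.1.4
  (complete `2`-descent), §X.1. [cite: SilvermanAEC2009, Prop. X.1.4]
-/

noncomputable section

open Polynomial NumberField Algebra Ideal IsDedekindDomain IsDedekindDomain.HeightOneSpectrum
open Literature.NumberTheory.EllipticCurves Literature.NumberTheory.EllipticCurves.Mod8Prime
open scoped WithZero

namespace Literature.NumberTheory.NumberFields

namespace CyclicCubic1339A

/-! ### The three reductions `ρ₁, ρ₂, ρ₃ : 𝓞 K → ℤ/8` -/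

/-- **`ρ₁ : 𝓞 K → ℤ/8`, `(θ, w) ↦ (6, 1)`** (the `2`-adic root `θ ≡ 6 mod 32`). [folklore] -/
def ρ₁ : 𝓞 K →+* ZMod 8 := ringHomOfImages (6 : ZMod 8) 1 (by decide) (by decide) (by decide)

/-- **`ρ₂ : 𝓞 K → ℤ/8`, `(θ, w) ↦ (4, 0)`** (the `2`-adic root `θ ≡ 28 mod 32`). [folklore] -/
def ρ₂ : 𝓞 K →+* ZMod 8 := ringHomOfImages (4 : ZMod 8) 0 (by decide) (by decide) (by decide)

/-- **`ρ₃ : 𝓞 K → ℤ/8`, `(θ, w) ↦ (5, 7)`** (the `2`-adic root `θ ≡ 29 mod 32`). [folklore] -/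
def ρ₃ : 𝓞 K →+* ZMod 8 := ringHomOfImages (5 : ZMod 8) 7 (by decide) (by decide) (by decide)

/-- `ρ₁ θ = 6`. [folklore] -/
@[simp] theorem ρ₁_θint : ρ₁ θint = 6 := ringHomOfImages_θint _ _ _ _ _
/-- `ρ₁ w = 1`. [folklore] -/
@[simp] theorem ρ₁_wint : ρ₁ wint = 1 := ringHomOfImages_wint _ _ _ _ _
/-- `ρ₂ θ = 4`. [folklore] -/
@[simp] theorem ρ₂_θint : ρ₂ θint = 4 := ringHomOfImages_θint _ _ _ _ _
/-- `ρ₂ w = 0`. [folklore] -/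
@[simp] theorem ρ₂_wint : ρ₂ wint = 0 := ringHomOfImages_wint _ _ _ _ _
/-- `ρ₃ θ = 5`. [folklore] -/
@[simp] theorem ρ₃_θint : ρ₃ θint = 5 := ringHomOfImages_θint _ _ _ _ _
/-- `ρ₃ w = 7`. [folklore] -/
@[simp] theorem ρ₃_wint : ρ₃ wint = 7 := ringHomOfImages_wint _ _ _ _ _

/-- Two ring homomorphisms on `𝓞 K` agreeing on `θ` and `w` are equal. [folklore] -/
theorem ringHom_ext {S : Type*} [Ring S] {f g : 𝓞 K →+* S} (hθ : f θint = g θint)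
    (hw : f wint = g wint) : f = g := by
  refine RingHom.ext fun z => ?_
  obtain ⟨a, b, c, rfl⟩ := exists_int_coords z
  simp only [map_add, map_mul, map_intCast, hθ, hw]

/-! ### `σ` on `𝓞 K` and `ρ₁ ∘ σ = ρ₃`, `ρ₃ ∘ σ = ρ₂`, `ρ₂ ∘ σ = ρ₁` -/

/-- **`σ` restricted to `𝓞 K`**. [folklore] -/
def σint : 𝓞 K ≃+* 𝓞 K := RingOfIntegers.mapRingEquiv σ.toRingEquiv

/-- `σint` is `σ` on `K`. [folklore] -/
@[simp] theorem coe_σint (a : 𝓞 K) : ((σint a : 𝓞 K) : K) = σ (a : K) := rfl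

/-- `σ θ = w - θ - 22` in `𝓞 K`. [folklore] -/
theorem σint_θint : σint θint = wint - θint - 22 := by
  apply RingOfIntegers.coe_injective
  simp only [coe_σint, coe_θint, map_sub, map_ofNat, coe_wint]
  exact σ_θ'

/-- `σ w = 21 - θ` in `𝓞 K`. [folklore] -/
theorem σint_wint : σint wint = 21 - θint := by
  apply RingOfIntegers.coe_injective
  simp only [coe_σint, coe_wint, map_sub, map_ofNat, coe_θint]
  exact σ_w

/-- `ρ₁ ∘ σ = ρ₃`. [folklore] -/
theorem ρ₁_comp_σint : ρ₁.comp σint.toRingHom = ρ₃ := by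
  refine ringHom_ext ?_ ?_
  · simp only [RingHom.coe_comp, RingEquiv.toRingHom_eq_coe, RingHom.coe_coe, Function.comp_apply,
      σint_θint, map_sub, map_ofNat, ρ₁_wint, ρ₁_θint, ρ₃_θint]
    decide
  · simp only [RingHom.coe_comp, RingEquiv.toRingHom_eq_coe, RingHom.coe_coe, Function.comp_apply,
      σint_wint, map_sub, map_ofNat, ρ₁_θint, ρ₃_wint]
    decide

/-- `ρ₃ ∘ σ = ρ₂`. [folklore] -/
theorem ρ₃_comp_σint : ρ₃.comp σint.toRingHom = ρ₂ := by
  refine ringHom_ext ?_ ?_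
  · simp only [RingHom.coe_comp, RingEquiv.toRingHom_eq_coe, RingHom.coe_coe, Function.comp_apply,
      σint_θint, map_sub, map_ofNat, ρ₃_wint, ρ₃_θint, ρ₂_θint]
    decide
  · simp only [RingHom.coe_comp, RingEquiv.toRingHom_eq_coe, RingHom.coe_coe, Function.comp_apply,
      σint_wint, map_sub, map_ofNat, ρ₃_θint, ρ₂_wint]
    decide

/-- `ρ₂ ∘ σ = ρ₁`. [folklore] -/
theorem ρ₂_comp_σint : ρ₂.comp σint.toRingHom = ρ₁ := by
  refine ringHom_ext ?_ ?_
  · simp only [RingHom.coe_comp, RingEquiv.toRingHom_eq_coe, RingHom.coe_coe, Function.comp_apply,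
      σint_θint, map_sub, map_ofNat, ρ₂_wint, ρ₂_θint, ρ₁_θint]
    decide
  · simp only [RingHom.coe_comp, RingEquiv.toRingHom_eq_coe, RingHom.coe_coe, Function.comp_apply,
      σint_wint, map_sub, map_ofNat, ρ₂_θint, ρ₁_wint]
    decide

/-- **Transport of classes along `σ`**: the class of `σ z` at `𝔭_ρ` is the class of `z` at
`𝔭_{ρ ∘ σ}`. [folklore] -/
theorem locQ_σ {ρ : 𝓞 K →+* ZMod 8} {z : K} {n : ℤ} {r : ZMod 8}
    (h : LocQ (ρ.comp σint.toRingHom) z n r) : LocQ ρ (σ z) n r := by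
  obtain ⟨u, s, hu, hs, hr, e⟩ := h
  refine ⟨σint u, σint s, ?_, ?_, ?_, ?_⟩
  · rw [not_mem_ideal_iff] at hu ⊢; exact hu
  · rw [not_mem_ideal_iff] at hs ⊢; exact hs
  · rw [← map_mul]; exact hr
  · have e' := congrArg σ e
    rw [map_mul, map_mul, map_zpow₀, map_ofNat] at e'
    exact e'

/-! ### The elements `π₁, π₂, π₃` with `(πᵢ) = 𝔭ᵢ³`, `π₁π₂π₃ = 8` -/

/-- **`π₁ = 1 - 3θ + w`** (`N(π₁) = 8`, `(π₁) = 𝔭₁³`). [folklore] -/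
def π₁ : 𝓞 K := 1 - 3 * θint + wint

/-- **`π₂ = σπ₁ = 88 + 2θ - 3w`** (`(π₂) = 𝔭₂³`). [folklore] -/
def π₂ : 𝓞 K := 88 + 2 * θint - 3 * wint

/-- **`π₃ = σ²π₁ = -19 + θ + 2w`** (`(π₃) = 𝔭₃³`). [folklore] -/
def π₃ : 𝓞 K := -19 + θint + 2 * wint

/-- `π₁` in `K`. [folklore] -/
@[simp] theorem coe_π₁ : ((π₁ : 𝓞 K) : K) = 1 - 3 * θ + w := by
  simp only [π₁, map_add, map_sub, map_mul, map_one, map_ofNat, coe_θint, coe_wint]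

/-- `π₂` in `K`. [folklore] -/
@[simp] theorem coe_π₂ : ((π₂ : 𝓞 K) : K) = 88 + 2 * θ - 3 * w := by
  simp only [π₂, map_add, map_sub, map_mul, map_ofNat, coe_θint, coe_wint]

/-- `π₃` in `K`. [folklore] -/
@[simp] theorem coe_π₃ : ((π₃ : 𝓞 K) : K) = -19 + θ + 2 * w := by
  simp only [π₃, map_add, map_mul, map_neg, map_ofNat, coe_θint, coe_wint]

/-- **`π₁ π₂ π₃ = 8` in `K`** (a polynomial identity modulo the relations of `1, θ, w`). [folklore] -/
theorem π_prod_K : (1 - 3 * θ + w) * (88 + 2 * θ - 3 * w) * (-19 + θ + 2 * w) = (8 : K) := by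
  linear_combination (-19 + θ + 2 * w) * ((-6 : K) * θ_sq + 11 * θ_mul_w + (-3) * w_sq) +
    47 * θ_sq + 72 * θ_mul_w + (-44) * w_sq

/-- **`π₁ π₂ π₃ = 8` in `𝓞 K`.** [folklore] -/
theorem π_prod : π₁ * π₂ * π₃ = 8 := by
  apply RingOfIntegers.coe_injective
  simp only [map_mul, map_ofNat, coe_π₁, coe_π₂, coe_π₃]
  exact π_prod_K

/-- `σπ₁ = π₂`, `σπ₂ = π₃`, `σπ₃ = π₁`. [folklore] -/
theorem σ_π : σ (1 - 3 * θ + w) = 88 + 2 * θ - 3 * w ∧ σ (88 + 2 * θ - 3 * w) = -19 + θ + 2 * w ∧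
    σ (-19 + θ + 2 * w) = 1 - 3 * θ + w := by
  simp only [map_add, map_sub, map_mul, map_neg, map_one, map_ofNat, σ_θ', σ_w]
  exact ⟨by ring, by ring, by ring⟩

/-- **`N(π₁) = N(π₂) = N(π₃) = 8`.** [folklore] -/
theorem norm_π : Algebra.norm ℚ ((π₁ : 𝓞 K) : K) = 8 ∧ Algebra.norm ℚ ((π₂ : 𝓞 K) : K) = 8 ∧
    Algebra.norm ℚ ((π₃ : 𝓞 K) : K) = 8 := by
  obtain ⟨s1, s2, s3⟩ := σ_π
  have inj := (algebraMap ℚ K).injective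
  refine ⟨inj ?_, inj ?_, inj ?_⟩
  · rw [norm_eq_mul_σ_mul_σσ, coe_π₁, s1, s2, map_ofNat]
    exact π_prod_K
  · rw [norm_eq_mul_σ_mul_σσ, coe_π₂, s2, s3, map_ofNat]
    linear_combination π_prod_K
  · rw [norm_eq_mul_σ_mul_σσ, coe_π₃, s3, s1, map_ofNat]
    linear_combination π_prod_K

/-! ### Residues: the values of `ρ₁, ρ₂, ρ₃` on `u₁, u₂, π₁, π₂, π₃` -/

/-- The values of `ρ₁`. [folklore] -/
theorem ρ₁_values : ρ₁ (unit₁ : 𝓞 K) = 3 ∧ ρ₁ (unit₂ : 𝓞 K) = 3 ∧ ρ₁ π₁ = 0 ∧ ρ₁ π₂ = 1 ∧ ρ₁ π₃ = 5 := by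
  simp only [coe_unit₁, coe_unit₂, π₁, π₂, π₃, map_add, map_sub, map_mul, map_neg, map_one, map_ofNat,
    ρ₁_θint, ρ₁_wint]
  decide

/-- The values of `ρ₂`. [folklore] -/
theorem ρ₂_values : ρ₂ (unit₁ : 𝓞 K) = 3 ∧ ρ₂ (unit₂ : 𝓞 K) = 1 ∧ ρ₂ π₁ = 5 ∧ ρ₂ π₂ = 0 ∧ ρ₂ π₃ = 1 := by
  simp only [coe_unit₁, coe_unit₂, π₁, π₂, π₃, map_add, map_sub, map_mul, map_neg, map_one, map_ofNat,
    ρ₂_θint, ρ₂_wint]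
  decide

/-- The values of `ρ₃`. [folklore] -/
theorem ρ₃_values : ρ₃ (unit₁ : 𝓞 K) = 1 ∧ ρ₃ (unit₂ : 𝓞 K) = 3 ∧ ρ₃ π₁ = 1 ∧ ρ₃ π₂ = 5 ∧ ρ₃ π₃ = 0 := by
  simp only [coe_unit₁, coe_unit₂, π₁, π₂, π₃, map_add, map_sub, map_mul, map_neg, map_one, map_ofNat,
    ρ₃_θint, ρ₃_wint]
  decide

/-! ### The `2`-adic classes `(ord, residue)` of `u₁, u₂, π₁, π₂, π₃` at `𝔭₁, 𝔭₂, 𝔭₃` -/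

/-- An element of odd residue is a `𝔭`-unit of class `(0, ρ)`. [folklore] -/
theorem locQ_of_isOdd (ρ : 𝓞 K →+* ZMod 8) {u : 𝓞 K} (h : IsOdd (ρ u)) : LocQ ρ ((u : 𝓞 K) : K) 0 (ρ u) :=
  (locU_coe ((not_mem_ideal_iff ρ).mpr h)).locQ

/-- **The class of `πₖ` at `𝔭ₖ` is `(3, ρₖ(πₗπₘ))`**: `πₖ · (πₗ πₘ) = 2³ · 1`. [folklore] -/
theorem locQ_of_prod_eq_eight (ρ : 𝓞 K →+* ZMod 8) {a b c : 𝓞 K} (habc : a * b * c = 8)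
    (hb : IsOdd (ρ b)) (hc : IsOdd (ρ c)) : LocQ ρ ((a : 𝓞 K) : K) 3 (ρ b * ρ c) := by
  have hbc : b * c ∉ ideal ρ := by
    rw [not_mem_ideal_iff, map_mul, isOdd_mul_iff]; exact ⟨hb, hc⟩
  have h1 : (1 : 𝓞 K) ∉ ideal ρ := by rw [not_mem_ideal_iff, map_one]; decide
  have h := locQ_of_mul_eq (ρ := ρ) (z := ((a : 𝓞 K) : K)) (k := 3) h1 hbc (by
    show algebraMap (𝓞 K) K a * algebraMap (𝓞 K) K (b * c) = (2 : K) ^ 3 * algebraMap (𝓞 K) K 1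
    rw [← map_mul, map_one, mul_one, ← mul_assoc, habc, map_ofNat]
    norm_num)
  rwa [one_mul, map_mul] at h

/-- Powers of classes (exponent `0` or `1` suffices, any `ℕ` is proved). [folklore] -/
theorem locQ_pow {ρ : 𝓞 K →+* ZMod 8} {z : K} {n : ℤ} {r : ZMod 8} (h : LocQ ρ z n r) :
    ∀ e : ℕ, LocQ ρ (z ^ e) (e * n) (r ^ e)
  | 0 => by simpa using (locU_one (ρ := ρ)).locQ
  | (e + 1) => by
      have h' := (locQ_pow h e).mul h
      rw [← pow_succ, ← pow_succ] at h'
      convert h' using 2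
      push_cast; ring

section Classes

/-- The classes at `𝔭₁`: `u₁ ↦ (0,3)`, `u₂ ↦ (0,3)`, `π₁ ↦ (3,5)`, `π₂ ↦ (0,1)`, `π₃ ↦ (0,5)`. [folklore] -/
theorem classes₁ : LocQ ρ₁ (((unit₁ : (𝓞 K)ˣ) : 𝓞 K) : K) 0 3 ∧ LocQ ρ₁ (((unit₂ : (𝓞 K)ˣ) : 𝓞 K) : K) 0 3 ∧
    LocQ ρ₁ ((π₁ : 𝓞 K) : K) 3 5 ∧ LocQ ρ₁ ((π₂ : 𝓞 K) : K) 0 1 ∧ LocQ ρ₁ ((π₃ : 𝓞 K) : K) 0 5 := by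
  obtain ⟨h1, h2, -, h4, h5⟩ := ρ₁_values
  refine ⟨?_, ?_, ?_, ?_, ?_⟩
  · have h := locQ_of_isOdd ρ₁ (u := (unit₁ : 𝓞 K)) (by rw [h1]; decide); rwa [h1] at h
  · have h := locQ_of_isOdd ρ₁ (u := (unit₂ : 𝓞 K)) (by rw [h2]; decide); rwa [h2] at h
  · have h := locQ_of_prod_eq_eight ρ₁ π_prod (by rw [h4]; decide) (by rw [h5]; decide)
    rwa [h4, h5, one_mul] at h
  · have h := locQ_of_isOdd ρ₁ (u := π₂) (by rw [h4]; decide); rwa [h4] at h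
  · have h := locQ_of_isOdd ρ₁ (u := π₃) (by rw [h5]; decide); rwa [h5] at h

/-- The classes at `𝔭₂`: `u₁ ↦ (0,3)`, `u₂ ↦ (0,1)`, `π₁ ↦ (0,5)`, `π₂ ↦ (3,5)`, `π₃ ↦ (0,1)`. [folklore] -/
theorem classes₂ : LocQ ρ₂ (((unit₁ : (𝓞 K)ˣ) : 𝓞 K) : K) 0 3 ∧ LocQ ρ₂ (((unit₂ : (𝓞 K)ˣ) : 𝓞 K) : K) 0 1 ∧
    LocQ ρ₂ ((π₁ : 𝓞 K) : K) 0 5 ∧ LocQ ρ₂ ((π₂ : 𝓞 K) : K) 3 5 ∧ LocQ ρ₂ ((π₃ : 𝓞 K) : K) 0 1 := by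
  obtain ⟨h1, h2, h3, -, h5⟩ := ρ₂_values
  have hprod : π₂ * π₃ * π₁ = 8 := by rw [← π_prod]; ring
  refine ⟨?_, ?_, ?_, ?_, ?_⟩
  · have h := locQ_of_isOdd ρ₂ (u := (unit₁ : 𝓞 K)) (by rw [h1]; decide); rwa [h1] at h
  · have h := locQ_of_isOdd ρ₂ (u := (unit₂ : 𝓞 K)) (by rw [h2]; decide); rwa [h2] at h
  · have h := locQ_of_isOdd ρ₂ (u := π₁) (by rw [h3]; decide); rwa [h3] at h
  · have h := locQ_of_prod_eq_eight ρ₂ hprod (by rw [h5]; decide) (by rw [h3]; decide)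
    rwa [h5, h3, one_mul] at h
  · have h := locQ_of_isOdd ρ₂ (u := π₃) (by rw [h5]; decide); rwa [h5] at h

/-- The classes at `𝔭₃`: `u₁ ↦ (0,1)`, `u₂ ↦ (0,3)`, `π₁ ↦ (0,1)`, `π₂ ↦ (0,5)`, `π₃ ↦ (3,5)`. [folklore] -/
theorem classes₃ : LocQ ρ₃ (((unit₁ : (𝓞 K)ˣ) : 𝓞 K) : K) 0 1 ∧ LocQ ρ₃ (((unit₂ : (𝓞 K)ˣ) : 𝓞 K) : K) 0 3 ∧
    LocQ ρ₃ ((π₁ : 𝓞 K) : K) 0 1 ∧ LocQ ρ₃ ((π₂ : 𝓞 K) : K) 0 5 ∧ LocQ ρ₃ ((π₃ : 𝓞 K) : K) 3 5 := by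
  obtain ⟨h1, h2, h3, h4, -⟩ := ρ₃_values
  have hprod : π₃ * π₁ * π₂ = 8 := by rw [← π_prod]; ring
  refine ⟨?_, ?_, ?_, ?_, ?_⟩
  · have h := locQ_of_isOdd ρ₃ (u := (unit₁ : 𝓞 K)) (by rw [h1]; decide); rwa [h1] at h
  · have h := locQ_of_isOdd ρ₃ (u := (unit₂ : 𝓞 K)) (by rw [h2]; decide); rwa [h2] at h
  · have h := locQ_of_isOdd ρ₃ (u := π₁) (by rw [h3]; decide); rwa [h3] at h
  · have h := locQ_of_isOdd ρ₃ (u := π₂) (by rw [h4]; decide); rwa [h4] at h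
  · have h := locQ_of_prod_eq_eight ρ₃ hprod (by rw [h3]; decide) (by rw [h4]; decide)
    rwa [h3, h4, one_mul] at h

end Classes

/-! ### The candidate classes `u₁^i u₂^j π₁^p π₂^q π₃^{p+q}` and their `2`-adic classes -/

/-- **The candidates `u₁^i u₂^j π₁^p π₂^q π₃^{p+q}`** (`i, j, p, q ∈ {0, 1}`): representatives of
the classes modulo squares with even total `2`-adic parity and positive norm. [folklore] -/
def cand (i j p q : Fin 2) : 𝓞 K :=
  (unit₁ : 𝓞 K) ^ (i : ℕ) * (unit₂ : 𝓞 K) ^ (j : ℕ) * π₁ ^ (p : ℕ) * π₂ ^ (q : ℕ) * π₃ ^ ((p + q : Fin 2) : ℕ)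

/-- The residue of a candidate at `𝔭₁`. [folklore] -/
def res₁ (i j p q : Fin 2) : ZMod 8 := 3 ^ (i : ℕ) * 3 ^ (j : ℕ) * 5 ^ (p : ℕ) * 1 ^ (q : ℕ) * 5 ^ ((p + q : Fin 2) : ℕ)

/-- The residue of a candidate at `𝔭₂`. [folklore] -/
def res₂ (i j p q : Fin 2) : ZMod 8 := 3 ^ (i : ℕ) * 1 ^ (j : ℕ) * 5 ^ (p : ℕ) * 5 ^ (q : ℕ) * 1 ^ ((p + q : Fin 2) : ℕ)

/-- The residue of a candidate at `𝔭₃`. [folklore] -/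
def res₃ (i j p q : Fin 2) : ZMod 8 := 1 ^ (i : ℕ) * 3 ^ (j : ℕ) * 1 ^ (p : ℕ) * 5 ^ (q : ℕ) * 5 ^ ((p + q : Fin 2) : ℕ)

/-- The candidates in `K`. [folklore] -/
theorem coe_cand (i j p q : Fin 2) : ((cand i j p q : 𝓞 K) : K) =
    (((unit₁ : (𝓞 K)ˣ) : 𝓞 K) : K) ^ (i : ℕ) * (((unit₂ : (𝓞 K)ˣ) : 𝓞 K) : K) ^ (j : ℕ) *
      ((π₁ : 𝓞 K) : K) ^ (p : ℕ) * ((π₂ : 𝓞 K) : K) ^ (q : ℕ) * ((π₃ : 𝓞 K) : K) ^ ((p + q : Fin 2) : ℕ) := by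
  simp only [cand, map_mul, map_pow]

/-- **The class of a candidate at `𝔭₁` is `(3p, res₁)`.** [folklore] -/
theorem locQ_cand₁ (i j p q : Fin 2) : LocQ ρ₁ ((cand i j p q : 𝓞 K) : K) (3 * (p : ℕ)) (res₁ i j p q) := by
  obtain ⟨h1, h2, h3, h4, h5⟩ := classes₁
  have h := ((((locQ_pow h1 i).mul (locQ_pow h2 j)).mul (locQ_pow h3 p)).mul (locQ_pow h4 q)).mul
    (locQ_pow h5 ((p + q : Fin 2) : ℕ))
  rw [coe_cand, res₁]
  convert h using 2
  ring

/-- **The class of a candidate at `𝔭₂` is `(3q, res₂)`.** [folklore] -/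
theorem locQ_cand₂ (i j p q : Fin 2) : LocQ ρ₂ ((cand i j p q : 𝓞 K) : K) (3 * (q : ℕ)) (res₂ i j p q) := by
  obtain ⟨h1, h2, h3, h4, h5⟩ := classes₂
  have h := ((((locQ_pow h1 i).mul (locQ_pow h2 j)).mul (locQ_pow h3 p)).mul (locQ_pow h4 q)).mul
    (locQ_pow h5 ((p + q : Fin 2) : ℕ))
  rw [coe_cand, res₂]
  convert h using 2
  ring

/-- **The class of a candidate at `𝔭₃` is `(3(p+q mod 2), res₃)`.** [folklore] -/
theorem locQ_cand₃ (i j p q : Fin 2) :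
    LocQ ρ₃ ((cand i j p q : 𝓞 K) : K) (3 * ((p + q : Fin 2) : ℕ)) (res₃ i j p q) := by
  obtain ⟨h1, h2, h3, h4, h5⟩ := classes₃
  have h := ((((locQ_pow h1 i).mul (locQ_pow h2 j)).mul (locQ_pow h3 p)).mul (locQ_pow h4 q)).mul
    (locQ_pow h5 ((p + q : Fin 2) : ℕ))
  rw [coe_cand, res₃]
  convert h using 2
  ring

/-! ### The real signs of the candidates -/

/-- The sign vector of an element of `K` under the three real embeddings. [folklore] -/
def sgn3 (z : K) : SignType × SignType × SignType := (SignType.sign (e₁ z), SignType.sign (e₂ z), SignType.sign (e₃ z))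

/-- `sgn3` is multiplicative. [folklore] -/
theorem sgn3_mul (z z' : K) : sgn3 (z * z') = sgn3 z * sgn3 z' := by
  simp only [sgn3, map_mul, sign_mul, Prod.mk_mul_mk]

/-- `sgn3` of a power. [folklore] -/
theorem sgn3_pow (z : K) (n : ℕ) : sgn3 (z ^ n) = sgn3 z ^ n := by
  induction n with
  | zero => simp only [pow_zero, sgn3, map_one, sign_one]; rfl
  | succ n ih => rw [pow_succ, sgn3_mul, ih, pow_succ]

/-- On units, `sgn3` is the sign vector `sgn`. [folklore] -/
theorem sgn3_coe_unit (u : (𝓞 K)ˣ) : sgn3 (((u : 𝓞 K)) : K) = sgn u := rfl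

/-- A non-zero square is totally positive. [folklore] -/
theorem sgn3_sq {B : K} (hB : B ≠ 0) : sgn3 (B ^ 2) = 1 := by
  have h : ∀ e : K →+* ℝ, SignType.sign (e (B ^ 2)) = 1 := fun e => by
    rw [map_pow]
    exact sign_pos (lt_of_le_of_ne (sq_nonneg _) (Ne.symm (pow_ne_zero 2 ((map_ne_zero e).mpr hB))))
  simp only [sgn3, h]; rfl

/-- The values of a real embedding on `π₁, π₂, π₃` as functions of `r = e(θ)`, and their product `8`.
[folklore] -/
theorem emb_π (e : K →+* ℝ) :
    e ((π₁ : 𝓞 K) : K) = ((e θ) ^ 2 - 33 * e θ + 18) / 14 ∧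
    e ((π₂ : 𝓞 K) : K) = (-3 * (e θ) ^ 2 + e θ + 1220) / 14 ∧
    e ((π₃ : 𝓞 K) : K) = ((e θ) ^ 2 + 16 * e θ - 129) / 7 ∧
    e ((π₁ : 𝓞 K) : K) * e ((π₂ : 𝓞 K) : K) * e ((π₃ : 𝓞 K) : K) = 8 := by
  refine ⟨?_, ?_, ?_, ?_⟩
  · simp only [coe_π₁, map_add, map_sub, map_mul, map_one, map_ofNat, emb_w]; ring
  · simp only [coe_π₂, map_sub, map_add, map_mul, map_ofNat, emb_w]; ring
  · simp only [coe_π₃, map_add, map_mul, map_neg, map_ofNat, emb_w]; ring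
  · rw [← map_mul, ← map_mul, coe_π₁, coe_π₂, coe_π₃, π_prod_K, map_ofNat]

/-- If `a b c = 8`, `b > 0`, `c < 0` then `a < 0`. [folklore] -/
theorem neg_of_prod {a b c : ℝ} (h : a * b * c = 8) (hb : 0 < b) (hc : c < 0) : a < 0 := by
  by_contra ha
  rw [not_lt] at ha
  have : a * b * c ≤ 0 := mul_nonpos_of_nonneg_of_nonpos (mul_nonneg ha hb.le) hc.le
  linarith

/-- **`sgn(π₁) = (+, -, -)`, `sgn(π₂) = (-, +, -)`, `sgn(π₃) = (-, -, +)`** (the three tiny values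
`e₂(π₁), e₃(π₂), e₁(π₃) ≈ -0.005` are signed through `e(π₁)e(π₂)e(π₃) = 8`). [folklore] -/
theorem sgn3_π : sgn3 ((π₁ : 𝓞 K) : K) = (1, -1, -1) ∧ sgn3 ((π₂ : 𝓞 K) : K) = (-1, 1, -1) ∧
    sgn3 ((π₃ : 𝓞 K) : K) = (-1, -1, 1) := by
  have h1 := r₁_spec.1; have h2 := r₂_spec.1; have h3 := r₃_spec.1
  simp only [Set.mem_Ioo] at h1 h2 h3
  obtain ⟨a1, b1, c1, p1⟩ := emb_π e₁
  obtain ⟨a2, b2, c2, p2⟩ := emb_π e₂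
  obtain ⟨a3, b3, c3, p3⟩ := emb_π e₃
  simp only [e₁_θ, e₂_θ, e₃_θ] at a1 b1 c1 a2 b2 c2 a3 b3 c3
  -- the six "large" values
  have ha1 : 0 < e₁ ((π₁ : 𝓞 K) : K) := by
    rw [a1]; refine div_pos ?_ (by norm_num); nlinarith [mul_pos (sub_pos.2 h1.1) (sub_pos.2 h1.2)]
  have hb1 : e₁ ((π₂ : 𝓞 K) : K) < 0 := by
    rw [b1]; refine div_neg_of_neg_of_pos ?_ (by norm_num); nlinarith [mul_pos (sub_pos.2 h1.1) (sub_pos.2 h1.2)]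
  have hb2 : 0 < e₂ ((π₂ : 𝓞 K) : K) := by
    rw [b2]; refine div_pos ?_ (by norm_num); nlinarith [mul_pos (sub_pos.2 h2.1) (sub_pos.2 h2.2)]
  have hc2 : e₂ ((π₃ : 𝓞 K) : K) < 0 := by
    rw [c2]; refine div_neg_of_neg_of_pos ?_ (by norm_num); nlinarith [mul_pos (sub_pos.2 h2.1) (sub_pos.2 h2.2)]
  have ha3 : e₃ ((π₁ : 𝓞 K) : K) < 0 := by
    rw [a3]; refine div_neg_of_neg_of_pos ?_ (by norm_num); nlinarith [mul_pos (sub_pos.2 h3.1) (sub_pos.2 h3.2)]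
  have hc3 : 0 < e₃ ((π₃ : 𝓞 K) : K) := by
    rw [c3]; refine div_pos ?_ (by norm_num); nlinarith [mul_pos (sub_pos.2 h3.1) (sub_pos.2 h3.2)]
  -- the three tiny ones through the product
  have hc1 : e₁ ((π₃ : 𝓞 K) : K) < 0 :=
    neg_of_prod (by linear_combination p1) ha1 hb1
  have ha2 : e₂ ((π₁ : 𝓞 K) : K) < 0 :=
    neg_of_prod (by linear_combination p2) hb2 hc2
  have hb3 : e₃ ((π₂ : 𝓞 K) : K) < 0 :=
    neg_of_prod (by linear_combination p3) hc3 ha3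
  simp only [sgn3, sign_pos ha1, sign_neg hb1, sign_neg hc1, sign_neg ha2, sign_pos hb2, sign_neg hc2,
    sign_neg ha3, sign_neg hb3, sign_pos hc3, and_self]

/-- The sign vector of a candidate (a table on `i, j, p, q`). [folklore] -/
def sgnCand (i j p q : Fin 2) : SignType × SignType × SignType :=
  ((-1, -1, 1) : SignType × SignType × SignType) ^ (i : ℕ) * ((-1, 1, -1) : SignType × SignType × SignType) ^ (j : ℕ) *
    ((1, -1, -1) : SignType × SignType × SignType) ^ (p : ℕ) * ((-1, 1, -1) : SignType × SignType × SignType) ^ (q : ℕ) *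
    ((-1, -1, 1) : SignType × SignType × SignType) ^ ((p + q : Fin 2) : ℕ)

/-- **`sgn3 (cand i j p q) = sgnCand i j p q`.** [folklore] -/
theorem sgn3_cand (i j p q : Fin 2) : sgn3 ((cand i j p q : 𝓞 K) : K) = sgnCand i j p q := by
  obtain ⟨s1, s2, s3⟩ := sgn3_π
  rw [coe_cand, sgn3_mul, sgn3_mul, sgn3_mul, sgn3_mul, sgn3_pow, sgn3_pow, sgn3_pow, sgn3_pow, sgn3_pow,
    sgn3_coe_unit, sgn3_coe_unit, sgn_unit₁, sgn_unit₂, s1, s2, s3, sgnCand]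

/-! ### The norms of the candidates are positive -/

/-- `N(cand i j p q) > 0` (`N(u₁) = N(u₂) = 1`, `N(πₖ) = 8`). [folklore] -/
theorem norm_cand_pos (i j p q : Fin 2) : 0 < Algebra.norm ℚ ((cand i j p q : 𝓞 K) : K) := by
  obtain ⟨n1, n2, n3⟩ := norm_π
  have hu1 : Algebra.norm ℚ (((unit₁ : (𝓞 K)ˣ) : 𝓞 K) : K) = 1 := by
    rw [coe_unit₁]
    simp only [map_add, map_mul, map_neg, map_ofNat, coe_θint, coe_wint]
    exact norm_u₁
  have hu2 : Algebra.norm ℚ (((unit₂ : (𝓞 K)ˣ) : 𝓞 K) : K) = 1 := by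
    rw [coe_unit₂]
    simp only [map_sub, map_mul, map_ofNat, coe_θint, coe_wint]
    exact norm_u₂
  rw [coe_cand]
  simp only [map_mul, map_pow, hu1, hu2, n1, n2, n3, one_pow, one_mul]
  positivity

/-! ### The primes above `2` are `𝔭₁, 𝔭₂, 𝔭₃`; valuations of `πₖ` away from `2` -/

/-- `N(𝔭_ρ) = 2`. [folklore] -/
theorem absNorm_ideal (ρ : 𝓞 K →+* ZMod 8) : absNorm (ideal ρ) = 2 := by
  haveI : Fact (Nat.Prime 2) := ⟨Nat.prime_two⟩
  have e := RingHom.quotientKerEquivOfSurjective (ZMod.ringHom_surjective (c82.comp ρ))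
  change absNorm (RingHom.ker (c82.comp ρ)) = 2
  rw [Ideal.absNorm_apply, Submodule.cardQuot_apply, Nat.card_congr e.toEquiv, Nat.card_zmod]

/-- The three primes `𝔭₁, 𝔭₂, 𝔭₃` are pairwise distinct. [folklore] -/
theorem ideal_ne : ideal ρ₁ ≠ ideal ρ₂ ∧ ideal ρ₁ ≠ ideal ρ₃ ∧ ideal ρ₂ ≠ ideal ρ₃ := by
  refine ⟨fun h => ?_, fun h => ?_, fun h => ?_⟩
  · have hw : wint ∈ ideal ρ₂ := by rw [mem_ideal_iff, ρ₂_wint]; decide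
    rw [← h, mem_ideal_iff, ρ₁_wint] at hw
    exact hw (by decide)
  · have hθ : θint ∈ ideal ρ₁ := by rw [mem_ideal_iff, ρ₁_θint]; decide
    rw [h, mem_ideal_iff, ρ₃_θint] at hθ
    exact hθ (by decide)
  · have hθ : θint ∈ ideal ρ₂ := by rw [mem_ideal_iff, ρ₂_θint]; decide
    rw [h, mem_ideal_iff, ρ₃_θint] at hθ
    exact hθ (by decide)

/-- **A finite place above `2` is one of `𝔭₁, 𝔭₂, 𝔭₃`** (three distinct primes of norm `2`
containing `2` multiply to `(2)`). [folklore] -/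
theorem eq_prime_of_two_mem {v : HeightOneSpectrum (𝓞 K)} (h2 : (2 : 𝓞 K) ∈ v.asIdeal) :
    v = prime ρ₁ ∨ v = prime ρ₂ ∨ v = prime ρ₃ := by
  haveI := v.isPrime
  obtain ⟨h12, h13, h23⟩ := ideal_ne
  have hv : v.asIdeal ∈ primesOver (span {((2 : ℕ) : ℤ)}) (𝓞 K) :=
    mem_primesOver_of_mem Nat.prime_two (by simpa using h2)
  rcases eq_of_mem_primesOver_split Nat.prime_two (isMaximal_ideal ρ₁) (isMaximal_ideal ρ₂) (isMaximal_ideal ρ₃)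
      h12 h13 h23 (by simpa using two_mem ρ₁) (by simpa using two_mem ρ₂) (by simpa using two_mem ρ₃)
      (absNorm_ideal ρ₁) (absNorm_ideal ρ₂) (absNorm_ideal ρ₃) hv with h | h | h
  · exact Or.inl (HeightOneSpectrum.ext h)
  · exact Or.inr (Or.inl (HeightOneSpectrum.ext h))
  · exact Or.inr (Or.inr (HeightOneSpectrum.ext h))

/-- For a natural number `n` and a finite place `v`: `v(n) = 1 ↔ n ∉ v`. [folklore] -/
theorem valuation_natCast_eq_one_iff (v : HeightOneSpectrum (𝓞 K)) (n : ℕ) :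
    v.valuation K (n : K) = 1 ↔ (n : 𝓞 K) ∉ v.asIdeal := by
  rw [show (n : K) = algebraMap (𝓞 K) K n by simp, valuation_of_algebraMap, intValuation_eq_one_iff]

/-- `v(n) ≤ 1` for a natural number `n`. [folklore] -/
theorem valuation_natCast_le_one (v : HeightOneSpectrum (𝓞 K)) (n : ℕ) : v.valuation K (n : K) ≤ 1 := by
  rw [show (n : K) = algebraMap (𝓞 K) K n by simp]; exact valuation_le_one v _

/-- In an ordered structure like `ℤᵐ⁰`: `a, b, c ≤ 1` and `abc = 1` force `a = b = c = 1`. [folklore] -/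
theorem eq_one_of_mul₃_eq_one {a b c : ℤᵐ⁰} (ha : a ≤ 1) (hb : b ≤ 1) (hc : c ≤ 1) (h : a * b * c = 1) :
    a = 1 ∧ b = 1 ∧ c = 1 := by
  have ha1 : a = 1 := by
    refine le_antisymm ha ?_
    calc 1 = a * b * c := h.symm
      _ ≤ a * 1 * 1 := by gcongr
      _ = a := by rw [mul_one, mul_one]
  have hb1 : b = 1 := by
    refine le_antisymm hb ?_
    calc 1 = a * b * c := h.symm
      _ ≤ 1 * b * 1 := by gcongr
      _ = b := by rw [one_mul, mul_one]
  refine ⟨ha1, hb1, ?_⟩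
  rwa [ha1, hb1, one_mul, one_mul] at h

/-- **Away from `2` the `πₖ` are units**: `v(π₁) = v(π₂) = v(π₃) = 1` if `2 ∉ v`. [folklore] -/
theorem valuation_π_eq_one {v : HeightOneSpectrum (𝓞 K)} (h2 : (2 : 𝓞 K) ∉ v.asIdeal) :
    v.valuation K ((π₁ : 𝓞 K) : K) = 1 ∧ v.valuation K ((π₂ : 𝓞 K) : K) = 1 ∧ v.valuation K ((π₃ : 𝓞 K) : K) = 1 := by
  have hv2 : v.valuation K (2 : K) = 1 := by exact_mod_cast (valuation_natCast_eq_one_iff v 2).mpr (by exact_mod_cast h2)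
  have h8 : v.valuation K (8 : K) = 1 := by
    rw [show (8 : K) = 2 ^ 3 by norm_num, map_pow, hv2, one_pow]
  have hprod : v.valuation K ((π₁ : 𝓞 K) : K) * v.valuation K ((π₂ : 𝓞 K) : K) * v.valuation K ((π₃ : 𝓞 K) : K) = 1 := by
    rw [← map_mul, ← map_mul, coe_π₁, coe_π₂, coe_π₃, π_prod_K, h8]
  exact eq_one_of_mul₃_eq_one (valuation_le_one v _) (valuation_le_one v _) (valuation_le_one v _) hprod

/-- `log v(cand) = 0` away from `2`. [folklore] -/
theorem valuation_cand_eq_one {v : HeightOneSpectrum (𝓞 K)} (h2 : (2 : 𝓞 K) ∉ v.asIdeal) (i j p q : Fin 2) :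
    v.valuation K ((cand i j p q : 𝓞 K) : K) = 1 := by
  obtain ⟨p1, p2, p3⟩ := valuation_π_eq_one h2
  have hu : ∀ u : (𝓞 K)ˣ, v.valuation K (((u : 𝓞 K)) : K) = 1 := fun u => by
    rw [show (((u : 𝓞 K)) : K) = algebraMap (𝓞 K) K u from rfl, valuation_of_algebraMap, intValuation_eq_one_iff]
    exact fun h => v.isPrime.ne_top (Ideal.eq_top_of_isUnit_mem _ h u.isUnit)
  rw [coe_cand]
  simp only [map_mul, map_pow, hu, p1, p2, p3, one_pow, one_mul]

/-! ### Valuations at `(3)`, `(5)` (inert): `σ`-invariance and norm parity -/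

/-- `(3)`, `(5)` are prime and are the only primes above `3`, `5`. [folklore] -/
theorem span_three_five : ((span {(3 : 𝓞 K)}).IsPrime ∧ ∀ P ∈ primesOver (span {(3 : ℤ)}) (𝓞 K), P = span {(3 : 𝓞 K)}) ∧
    ((span {(5 : 𝓞 K)}).IsPrime ∧ ∀ P ∈ primesOver (span {(5 : ℤ)}) (𝓞 K), P = span {(5 : 𝓞 K)}) := by
  have h3 := span_inert (p := 3) (Or.inl rfl)
  have h5 := span_inert (p := 5) (Or.inr rfl)
  push_cast at h3 h5
  exact ⟨⟨h3.1, h3.2.2⟩, ⟨h5.1, h5.2.2⟩⟩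

/-- A ring automorphism of `𝓞 K` does not increase the valuation at an inert prime `(p)`. [folklore] -/
theorem intValuation_ringEquiv_le (v : HeightOneSpectrum (𝓞 K)) {p : ℕ} (hv : v.asIdeal = span {(p : 𝓞 K)})
    (τ : 𝓞 K ≃+* 𝓞 K) (a : 𝓞 K) : v.intValuation (τ a) ≤ v.intValuation a := by
  by_cases ha : a = 0
  · simp [ha]
  have key : ∀ (b : 𝓞 K) (n : ℕ), v.intValuation b ≤ WithZero.exp (-(n : ℤ)) ↔ (p : 𝓞 K) ^ n ∣ b := by
    intro b n
    rw [intValuation_le_pow_iff_dvd, hv, Ideal.span_singleton_pow, dvd_span_singleton,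
      Ideal.mem_span_singleton]
  have hva : v.intValuation a ≠ 0 := intValuation_ne_zero v a ha
  obtain ⟨m, hm⟩ : ∃ m : ℕ, v.intValuation a = WithZero.exp (-(m : ℤ)) := by
    have hle : WithZero.log (v.intValuation a) ≤ 0 := by
      rw [← WithZero.log_one]
      exact (WithZero.log_le_log hva one_ne_zero).mpr (intValuation_le_one v a)
    refine ⟨(-WithZero.log (v.intValuation a)).toNat, ?_⟩
    rw [Int.toNat_of_nonneg (by omega), neg_neg, WithZero.exp_log hva]
  rw [hm, key]
  have h := (key a m).mp hm.le
  simpa using map_dvd τ h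

/-- `v_{(p)}(τ a) = v_{(p)}(a)` for a ring automorphism `τ` of `𝓞 K` and an inert `p`. [folklore] -/
theorem intValuation_ringEquiv_eq (v : HeightOneSpectrum (𝓞 K)) {p : ℕ} (hv : v.asIdeal = span {(p : 𝓞 K)})
    (τ : 𝓞 K ≃+* 𝓞 K) (a : 𝓞 K) : v.intValuation (τ a) = v.intValuation a := by
  refine le_antisymm (intValuation_ringEquiv_le v hv τ a) ?_
  have := intValuation_ringEquiv_le v hv τ.symm (τ a)
  rwa [τ.symm_apply_apply] at this

/-- **`σ` preserves the valuation of `K` at an inert prime `(p)`.** [folklore] -/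
theorem valuation_σ_eq (v : HeightOneSpectrum (𝓞 K)) {p : ℕ} (hv : v.asIdeal = span {(p : 𝓞 K)}) (z : K) :
    v.valuation K (σ z) = v.valuation K z := by
  obtain ⟨a, b, hb, rfl⟩ := IsFractionRing.div_surjective (A := 𝓞 K) z
  have e : σ (algebraMap (𝓞 K) K a / algebraMap (𝓞 K) K b) =
      algebraMap (𝓞 K) K (σint a) / algebraMap (𝓞 K) K (σint b) := by
    rw [map_div₀]; rfl
  rw [e, map_div₀, map_div₀, valuation_of_algebraMap, valuation_of_algebraMap, valuation_of_algebraMap,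
    valuation_of_algebraMap, intValuation_ringEquiv_eq v hv, intValuation_ringEquiv_eq v hv]

/-- **Norm parity at an inert prime**: if `N_{K/ℚ}(z)` is a rational square then `ord_{(p)}(z)` is
even (`N(z) = z·σz·σ²z` has order `3 ord(z)`). [folklore] -/
theorem two_dvd_log_valuation_of_isSquare_norm (v : HeightOneSpectrum (𝓞 K)) {p : ℕ}
    (hv : v.asIdeal = span {(p : 𝓞 K)}) {z : K} (hz : z ≠ 0) (h : IsSquare (Algebra.norm ℚ z)) :
    (2 : ℤ) ∣ WithZero.log (v.valuation K z) := by
  obtain ⟨r, hr⟩ := h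
  have hN := norm_eq_mul_σ_mul_σσ z
  rw [hr, map_mul] at hN
  have hz1 : σ z ≠ 0 := (map_ne_zero σ).mpr hz
  have hz2 : σ (σ z) ≠ 0 := (map_ne_zero σ).mpr hz1
  have hr0 : (algebraMap ℚ K r) ≠ 0 := by
    intro h0
    rw [h0, zero_mul] at hN
    exact mul_ne_zero (mul_ne_zero hz hz1) hz2 hN.symm
  have hv0 : v.valuation K z ≠ 0 := (Valuation.ne_zero_iff _).mpr hz
  have hvr : v.valuation K (algebraMap ℚ K r) ≠ 0 := (Valuation.ne_zero_iff _).mpr hr0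
  have key : WithZero.log (v.valuation K (algebraMap ℚ K r * algebraMap ℚ K r)) =
      WithZero.log (v.valuation K (z * σ z * σ (σ z))) := by rw [hN]
  rw [map_mul, map_mul, map_mul, WithZero.log_mul hvr hvr,
    WithZero.log_mul (mul_ne_zero hv0 ((Valuation.ne_zero_iff _).mpr hz1)) ((Valuation.ne_zero_iff _).mpr hz2),
    WithZero.log_mul hv0 ((Valuation.ne_zero_iff _).mpr hz1), valuation_σ_eq v hv, valuation_σ_eq v hv,
    valuation_σ_eq v hv] at key
  exact ⟨WithZero.log (v.valuation K (algebraMap ℚ K r)) - WithZero.log (v.valuation K z), by linarith⟩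

/-! ### Norm parity at the split prime `2`: `n₁ + n₂ + n₃` is even -/

/-- **The total `2`-adic order is even**: if `N_{K/ℚ}(z) ∈ ℚˣ²` and `z` has classes `(nₖ, rₖ)` at
`𝔭ₖ`, then `2 ∣ n₁ + n₂ + n₃` (`N(z) = z · σz · σ²z` has class `n₁ + n₃ + n₂` at `𝔭₁`). [folklore] -/
theorem two_dvd_sum_of_isSquare_norm {z : K} (hN : IsSquare (Algebra.norm ℚ z)) {n₁ n₂ n₃ : ℤ}
    {r₁ r₂ r₃ : ZMod 8} (h₁ : LocQ ρ₁ z n₁ r₁) (h₂ : LocQ ρ₂ z n₂ r₂) (h₃ : LocQ ρ₃ z n₃ r₃) :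
    (2 : ℤ) ∣ n₁ + n₂ + n₃ := by
  obtain ⟨c, hc⟩ := hN
  have hN' := norm_eq_mul_σ_mul_σσ z
  rw [hc, map_mul] at hN'
  -- classes of `σ z`, `σ (σ z)` at `𝔭₁`
  have hσ : LocQ ρ₁ (σ z) n₃ r₃ := locQ_σ (by rw [ρ₁_comp_σint]; exact h₃)
  have hσσ : LocQ ρ₁ (σ (σ z)) n₂ r₂ := by
    refine locQ_σ (ρ := ρ₁) ?_
    rw [ρ₁_comp_σint]
    exact locQ_σ (by rw [ρ₃_comp_σint]; exact h₂)
  have hprod := (h₁.mul hσ).mul hσσ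
  rw [← hN'] at hprod
  -- class of `c²`
  have hc0 : (algebraMap ℚ K c) ≠ 0 := fun h0 => LocQ.ne_zero hprod (by rw [h0, zero_mul])
  obtain ⟨m, s, hm⟩ := exists_locQ (ρ := ρ₁) hc0
  have hsq := hm.sq
  rw [pow_two] at hsq
  obtain ⟨e, -⟩ := hprod.unique hsq
  exact ⟨m, by linarith⟩

/-! ### The curve: even valuations of `x/γ` and `(x + 2)/γ'` -/

section Curve

variable {x y : K} (hE : y ^ 2 = x * (x + 2) * (x - 3)) (hy : y ≠ 0)
include hE hy

/-- `x ≠ 0`, `x + 2 ≠ 0`, `x - 3 ≠ 0` for a point with `y ≠ 0`. [folklore] -/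
theorem x_ne : x ≠ 0 ∧ x + 2 ≠ 0 ∧ x - 3 ≠ 0 := by
  have h : x * (x + 2) * (x - 3) ≠ 0 := by rw [← hE]; exact pow_ne_zero 2 hy
  exact ⟨fun h0 => h (by rw [h0]; ring), fun h0 => h (by rw [h0]; ring), fun h0 => h (by rw [h0]; ring)⟩

/-- **`ord_v(x)` is even at every `v ∤ 2`**: at the inert `(3)` by `N(x) = □`, elsewhere by the
parity lemma (`e = (0, -2, 3)`). [folklore] -/
theorem two_dvd_log_valuation_x (hN : IsSquare (Algebra.norm ℚ x)) (v : HeightOneSpectrum (𝓞 K))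
    (h2 : (2 : 𝓞 K) ∉ v.asIdeal) : (2 : ℤ) ∣ WithZero.log (v.valuation K x) := by
  obtain ⟨hx0, -, -⟩ := x_ne hE hy
  by_cases h3 : (3 : 𝓞 K) ∈ v.asIdeal
  · have hv : v.asIdeal = span {((3 : ℕ) : 𝓞 K)} := by
      haveI := v.isPrime
      exact_mod_cast span_three_five.1.2 v.asIdeal (by simpa using mem_primesOver_of_mem Nat.prime_three (by simpa using h3))
    exact two_dvd_log_valuation_of_isSquare_norm v hv hx0 hN
  have hv2 : v.valuation K (2 : K) = 1 := by exact_mod_cast (valuation_natCast_eq_one_iff v 2).mpr (by exact_mod_cast h2)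
  have hv3 : v.valuation K (3 : K) = 1 := by exact_mod_cast (valuation_natCast_eq_one_iff v 3).mpr (by exact_mod_cast h3)
  have key := (v.valuation K).two_dvd_log_map_sub_of_sq_eq (e₁ := 0) (e₂ := -2) (e₃ := 3) (x := x) (y := y)
    (by rw [map_zero]; exact zero_le_one) (by simp only [Valuation.map_neg, hv2, le_refl]) (by rw [hv3])
    (by simp only [zero_sub, Valuation.map_neg, hv2]) (by simp only [zero_sub, Valuation.map_neg, hv3]) hx0
    (by rw [hE]; ring)
  rwa [sub_zero] at key

/-- **`ord_v(x + 2)` is even at every `v ∤ 2`**: at the inert `(5)` by `N(x + 2) = □`, elsewhere by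
the parity lemma (`e = (-2, 0, 3)`). [folklore] -/
theorem two_dvd_log_valuation_x_add_two (hN : IsSquare (Algebra.norm ℚ (x + 2))) (v : HeightOneSpectrum (𝓞 K))
    (h2 : (2 : 𝓞 K) ∉ v.asIdeal) : (2 : ℤ) ∣ WithZero.log (v.valuation K (x + 2)) := by
  obtain ⟨hx0, hx2, -⟩ := x_ne hE hy
  by_cases h5 : (5 : 𝓞 K) ∈ v.asIdeal
  · have hv : v.asIdeal = span {((5 : ℕ) : 𝓞 K)} := by
      haveI := v.isPrime
      exact_mod_cast span_three_five.2.2 v.asIdeal (by simpa using mem_primesOver_of_mem Nat.prime_five (by simpa using h5))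
    exact two_dvd_log_valuation_of_isSquare_norm v hv hx2 hN
  have hv2 : v.valuation K (2 : K) = 1 := by exact_mod_cast (valuation_natCast_eq_one_iff v 2).mpr (by exact_mod_cast h2)
  have hv5 : v.valuation K (5 : K) = 1 := by exact_mod_cast (valuation_natCast_eq_one_iff v 5).mpr (by exact_mod_cast h5)
  have hv3 : v.valuation K (3 : K) ≤ 1 := by exact_mod_cast valuation_natCast_le_one v 3
  have key := (v.valuation K).two_dvd_log_map_sub_of_sq_eq (e₁ := -2) (e₂ := 0) (e₃ := 3) (x := x) (y := y)
    (by simp only [Valuation.map_neg, hv2, le_refl]) (by rw [map_zero]; exact zero_le_one) hv3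
    (by simp only [sub_zero, Valuation.map_neg, hv2])
    (by rw [show (-2 : K) - 3 = -5 by norm_num]; simp only [Valuation.map_neg, hv5])
    (by rw [Ne, ← sub_eq_zero, sub_neg_eq_add]; exact hx2) (by rw [hE]; ring)
  rwa [sub_neg_eq_add] at key

omit hE hy in
/-- **Extraction of the class representative**: if `z ≠ 0` has `N(z) ∈ ℚˣ²` and even valuation at
every `v ∤ 2`, then `z = (-1)^a · cand i j p q · A²` (`p ≡ n₁`, `q ≡ n₂`: the classes of `z` at
`𝔭₁, 𝔭₂, 𝔭₃` have exponents of even sum, `z/γ` has all valuations even, the class group has odd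
order, and the units are `±u₁^i u₂^j` modulo squares). [folklore] -/
theorem exists_eq_cand_mul_sq {z : K} (hz : z ≠ 0) (hN : IsSquare (Algebra.norm ℚ z))
    (heven : ∀ v : HeightOneSpectrum (𝓞 K), (2 : 𝓞 K) ∉ v.asIdeal → (2 : ℤ) ∣ WithZero.log (v.valuation K z)) :
    ∃ (a i j p q : Fin 2) (A : K), A ≠ 0 ∧ z = (((rep a 0 0 : (𝓞 K)ˣ) : 𝓞 K) : K) * ((cand i j p q : 𝓞 K) : K) * A ^ 2 := by
  obtain ⟨n₁, r₁, h₁⟩ := exists_locQ (ρ := ρ₁) hz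
  obtain ⟨n₂, r₂, h₂⟩ := exists_locQ (ρ := ρ₂) hz
  obtain ⟨n₃, r₃, h₃⟩ := exists_locQ (ρ := ρ₃) hz
  have hsum := two_dvd_sum_of_isSquare_norm hN h₁ h₂ h₃
  -- the parities `p, q`
  obtain ⟨p, hp⟩ : ∃ p : Fin 2, (2 : ℤ) ∣ n₁ - 3 * (p : ℕ) := by
    rcases Int.emod_two_eq_zero_or_one n₁ with h | h
    · exact ⟨0, by simp only [Fin.val_zero, Nat.cast_zero, mul_zero, sub_zero]; omega⟩
    · exact ⟨1, by simp only [Fin.val_one, Nat.cast_one, mul_one]; omega⟩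
  obtain ⟨q, hq⟩ : ∃ q : Fin 2, (2 : ℤ) ∣ n₂ - 3 * (q : ℕ) := by
    rcases Int.emod_two_eq_zero_or_one n₂ with h | h
    · exact ⟨0, by simp only [Fin.val_zero, Nat.cast_zero, mul_zero, sub_zero]; omega⟩
    · exact ⟨1, by simp only [Fin.val_one, Nat.cast_one, mul_one]; omega⟩
  have hpq : (2 : ℤ) ∣ n₃ - 3 * ((p + q : Fin 2) : ℕ) := by
    have e : (((p + q : Fin 2) : ℕ) : ℤ) = ((p : ℕ) + (q : ℕ) : ℤ) % 2 := by
      fin_cases p <;> fin_cases q <;> decide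
    omega
  have hγ0 : ((cand 0 0 p q : 𝓞 K) : K) ≠ 0 := (locQ_cand₁ 0 0 p q).ne_zero
  -- all valuations of `z/γ` are even
  have hall : ∀ v : HeightOneSpectrum (𝓞 K), (2 : ℤ) ∣ WithZero.log (v.valuation K (z / ((cand 0 0 p q : 𝓞 K) : K))) := by
    intro v
    have hvz : v.valuation K z ≠ 0 := (Valuation.ne_zero_iff _).mpr hz
    have hvγ : v.valuation K ((cand 0 0 p q : 𝓞 K) : K) ≠ 0 := (Valuation.ne_zero_iff _).mpr hγ0
    rw [map_div₀, WithZero.log_div hvz hvγ]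
    by_cases h2 : (2 : 𝓞 K) ∈ v.asIdeal
    · rcases eq_prime_of_two_mem h2 with rfl | rfl | rfl
      · rw [h₁.log_valuation_eq, (locQ_cand₁ 0 0 p q).log_valuation_eq]; omega
      · rw [h₂.log_valuation_eq, (locQ_cand₂ 0 0 p q).log_valuation_eq]; omega
      · rw [h₃.log_valuation_eq, (locQ_cand₃ 0 0 p q).log_valuation_eq]; omega
    · rw [valuation_cand_eq_one h2, WithZero.log_one, sub_zero]
      exact heven v h2
  obtain ⟨u, w', hw⟩ := exists_unit_mul_sq_of_even_valuation (div_ne_zero hz hγ0) hall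
  obtain ⟨a, i, j, η, hu⟩ := exists_eq_rep_mul_sq u
  have hz' : z = ((cand 0 0 p q : 𝓞 K) : K) * (algebraMap (𝓞 K) K u * w' ^ 2) := by
    rw [← hw, mul_comm, div_mul_cancel₀ _ hγ0]
  have heq : z = (((rep a 0 0 : (𝓞 K)ˣ) : 𝓞 K) : K) * ((cand i j p q : 𝓞 K) : K) *
      ((((η : (𝓞 K)ˣ) : 𝓞 K) : K) * w') ^ 2 := by
    rw [hz', hu]
    simp only [rep, Units.val_mul, Units.val_pow_eq_pow_val, Units.val_neg, Units.val_one, Fin.val_zero,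
      pow_zero, mul_one, map_mul, map_pow, map_neg, map_one, coe_cand, one_mul]
    ring
  refine ⟨a, i, j, p, q, (((η : (𝓞 K)ˣ) : 𝓞 K) : K) * w', fun h0 => hz ?_, heq⟩
  rw [heq, h0]
  ring

omit hE hy in
/-- The norm of `(-1)^a`: `(-1)^a`. [folklore] -/
theorem norm_rep_sign (a : Fin 2) : Algebra.norm ℚ ((((rep a 0 0 : (𝓞 K)ˣ) : 𝓞 K) : K)) = (-1) ^ (a : ℕ) := by
  have hneg : Algebra.norm ℚ (-1 : K) = -1 := by
    rw [show (-1 : K) = algebraMap ℚ K (-1) by simp, Algebra.norm_algebraMap, finrank_K]; norm_num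
  have hcoe : (((rep a 0 0 : (𝓞 K)ˣ) : 𝓞 K) : K) = (-1) ^ (a : ℕ) := by
    simp only [rep, Units.val_pow_eq_pow_val, Units.val_neg, Units.val_one, Fin.val_zero, pow_zero,
      mul_one, map_pow, map_neg, map_one]
  rw [hcoe, map_pow, hneg]

omit hE hy in
/-- **The sign is killed by `N > 0`**: in `z = (-1)^a · cand · A²` with `N(z) ∈ ℚˣ²`, `a = 0`. [folklore] -/
theorem sign_eq_zero {z : K} (hN : IsSquare (Algebra.norm ℚ z)) {a i j p q : Fin 2} {A : K} (hA : A ≠ 0)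
    (hz : z = (((rep a 0 0 : (𝓞 K)ˣ) : 𝓞 K) : K) * ((cand i j p q : 𝓞 K) : K) * A ^ 2) : a = 0 := by
  have hNz : Algebra.norm ℚ z = (-1) ^ (a : ℕ) * Algebra.norm ℚ ((cand i j p q : 𝓞 K) : K) * (Algebra.norm ℚ A) ^ 2 := by
    rw [hz, map_mul, map_mul, map_pow, norm_rep_sign]
  have hc := norm_cand_pos i j p q
  have hq : Algebra.norm ℚ A ≠ 0 := Algebra.norm_ne_zero_iff.mpr hA
  by_contra ha
  obtain rfl : a = 1 := by fin_cases a; exact absurd rfl ha; rfl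
  simp only [Fin.val_one, pow_one, neg_mul, one_mul] at hNz
  have hlt : Algebra.norm ℚ z < 0 := by rw [hNz]; nlinarith [sq_pos_iff.mpr hq]
  linarith [hN.nonneg]

/-- **`x + 2` is totally positive** for a `K`-point of `y² = x(x+2)(x-3)` with `y ≠ 0`. [folklore] -/
theorem sgn3_x_add_two : sgn3 (x + 2) = 1 := by
  have h : ∀ e : K →+* ℝ, SignType.sign (e (x + 2)) = 1 := fun e => by
    rw [map_add, map_ofNat]
    have hEe := congrArg e hE
    simp only [map_pow, map_mul, map_add, map_sub, map_ofNat] at hEe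
    have hye : e y ≠ 0 := (map_ne_zero e).mpr hy
    refine sign_pos ?_
    by_contra hle
    rw [not_lt] at hle
    have h1 : 0 < e x * (e x - 3) := by nlinarith
    have h3 : 0 < e y ^ 2 := lt_of_le_of_ne (sq_nonneg _) (Ne.symm (pow_ne_zero 2 hye))
    nlinarith
  simp only [sgn3, h]; rfl

end Curve

/-! ### The finite check and the assembly -/

set_option synthInstance.maxSize 1024 in
/-- **The finite check**: among the `2⁸` pairs of candidates, the three local conditions at
`𝔭₁, 𝔭₂, 𝔭₃` and total positivity of the second leave only the trivial pair. [folklore] -/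
theorem final_check : ∀ i j p q i' j' p' q' : Fin 2,
    W480 (3 * (p : ℕ)) (3 * (p' : ℕ)) (res₁ i j p q) (res₁ i' j' p' q') →
    W480 (3 * (q : ℕ)) (3 * (q' : ℕ)) (res₂ i j p q) (res₂ i' j' p' q') →
    W480 (3 * ((p + q : Fin 2) : ℕ)) (3 * ((p' + q' : Fin 2) : ℕ)) (res₃ i j p q) (res₃ i' j' p' q') →
    sgnCand i' j' p' q' = 1 →
    i = 0 ∧ j = 0 ∧ p = 0 ∧ q = 0 ∧ i' = 0 ∧ j' = 0 ∧ p' = 0 ∧ q' = 0 := by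
  decide +kernel

/-- **The norm-`1` `2`-descent statement for `480a1` over the cyclic cubic field of conductor
`1339` in which `2` splits.** For every `K`-point `(x, y)`, `y ≠ 0`, of `y² = x(x + 2)(x - 3)` such
that `N_{K/ℚ}(x)` and `N_{K/ℚ}(x + 2)` are rational squares, `x` and `x + 2` are squares in `K`.
[cite: DokchitserDokchitser2011RankModN, proof of Thm. 2] -/
theorem normDescent {x y : K} (hE : y ^ 2 = x * (x + 2) * (x - 3)) (hy : y ≠ 0)
    (hNx : IsSquare (Algebra.norm ℚ x)) (hNx2 : IsSquare (Algebra.norm ℚ (x + 2))) :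
    IsSquare x ∧ IsSquare (x + 2) := by
  obtain ⟨hx0, hx2, -⟩ := x_ne hE hy
  obtain ⟨a, i, j, p, q, A, hA, hxA⟩ := exists_eq_cand_mul_sq hx0 hNx (two_dvd_log_valuation_x hE hy hNx)
  obtain ⟨a', i', j', p', q', B, hB, hxB⟩ :=
    exists_eq_cand_mul_sq hx2 hNx2 (two_dvd_log_valuation_x_add_two hE hy hNx2)
  obtain rfl := sign_eq_zero hNx hA hxA
  obtain rfl := sign_eq_zero hNx2 hB hxB
  have hrep : (((rep 0 0 0 : (𝓞 K)ˣ) : 𝓞 K) : K) = 1 := by simp [rep]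
  rw [hrep, one_mul] at hxA hxB
  -- the local conditions
  have W1 := localImage hE hy hxA hxB (locQ_cand₁ i j p q) (locQ_cand₁ i' j' p' q')
  have W2 := localImage hE hy hxA hxB (locQ_cand₂ i j p q) (locQ_cand₂ i' j' p' q')
  have W3 := localImage hE hy hxA hxB (locQ_cand₃ i j p q) (locQ_cand₃ i' j' p' q')
  -- the sign condition
  have hs : sgnCand i' j' p' q' = 1 := by
    have h := sgn3_x_add_two hE hy
    rw [hxB, sgn3_mul, sgn3_sq hB, mul_one, sgn3_cand] at h
    exact h
  obtain ⟨rfl, rfl, rfl, rfl, rfl, rfl, rfl, rfl⟩ := final_check i j p q i' j' p' q' W1 W2 W3 hs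
  have h1 : ((cand 0 0 0 0 : 𝓞 K) : K) = 1 := by simp [coe_cand]
  rw [h1, one_mul] at hxA hxB
  exact ⟨⟨A, by rw [hxA, pow_two]⟩, ⟨B, by rw [hxB, pow_two]⟩⟩

/-! ### Transport to any cubic field generated by a root of `f'` -/

section Transport

variable {K' : Type*} [Field K'] [Algebra ℚ K']

/-- `f'(z) = z³ + z² - 446z + 248` as the value of `aeval`. [folklore] -/
theorem aeval_cubicPolyRat (z : K') : aeval z cubicPolyRat = z ^ 3 + z ^ 2 - 446 * z + 248 := by
  refine (aeval_map_algebraMap ℚ z cubicPoly).trans ?_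
  simp only [cubicPoly, map_add, map_sub, map_mul, map_pow, aeval_X, map_ofNat]

/-- **The homomorphism `K = ℚ[X]/(f') → K'`, `θ ↦ θ'`**, for a root `θ'` of `f'` in `K'`. [folklore] -/
def algHomOfRoot {θ' : K'} (h : θ' ^ 3 + θ' ^ 2 - 446 * θ' + 248 = 0) : K →ₐ[ℚ] K' :=
  AdjoinRoot.liftAlgHom cubicPolyRat (Algebra.ofId ℚ K') θ'
    (show aeval θ' cubicPolyRat = 0 by rw [aeval_cubicPolyRat, h])

/-- **`K ≃ₐ[ℚ] K'` for every cubic extension `K'/ℚ` containing a root of `f'`.** [folklore] -/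
def algEquivOfRoot (h3 : Module.finrank ℚ K' = 3) {θ' : K'}
    (h : θ' ^ 3 + θ' ^ 2 - 446 * θ' + 248 = 0) : K ≃ₐ[ℚ] K' :=
  haveI : FiniteDimensional ℚ K' := Module.finite_of_finrank_eq_succ h3
  AlgEquiv.ofBijective (algHomOfRoot h)
    ⟨(algHomOfRoot h).toRingHom.injective,
     (LinearMap.injective_iff_surjective_of_finrank_eq_finrank (f := (algHomOfRoot h).toLinearMap)
        (by rw [finrank_K, h3])).mp (algHomOfRoot h).toRingHom.injective⟩

/-- Squares are preserved by ring isomorphisms. [folklore] -/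
theorem isSquare_map_of_isSquare (e : K ≃ₐ[ℚ] K') {z : K} (hz : IsSquare z) : IsSquare (e z) := by
  obtain ⟨r, hr⟩ := hz
  exact ⟨e r, by rw [hr, map_mul]⟩

/-- **Transport of `normDescent` along `K ≃ₐ[ℚ] K'`.** [folklore] -/
theorem normDescent_of_algEquiv (e : K ≃ₐ[ℚ] K') {x y : K'} (hE : y ^ 2 = x * (x + 2) * (x - 3))
    (hy : y ≠ 0) (hNx : IsSquare (Algebra.norm ℚ x)) (hNx2 : IsSquare (Algebra.norm ℚ (x + 2))) :
    IsSquare x ∧ IsSquare (x + 2) := by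
  set x₀ := e.symm x with hx₀
  set y₀ := e.symm y with hy₀
  have hx : x = e x₀ := (e.apply_symm_apply x).symm
  have hyy : y = e y₀ := (e.apply_symm_apply y).symm
  have hE₀ : y₀ ^ 2 = x₀ * (x₀ + 2) * (x₀ - 3) := by
    apply e.injective
    rw [map_pow, map_mul, map_mul, map_add, map_sub, map_ofNat, map_ofNat, ← hx, ← hyy, hE]
  have hy₀' : y₀ ≠ 0 := fun h => hy (by rw [hyy, h, map_zero])
  have hN₀ : Algebra.norm ℚ x₀ = Algebra.norm ℚ x := by
    rw [hx, Algebra.norm_eq_of_algEquiv e x₀]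
  have hN₂ : Algebra.norm ℚ (x₀ + 2) = Algebra.norm ℚ (x + 2) := by
    rw [← Algebra.norm_eq_of_algEquiv e (x₀ + 2), map_add, map_ofNat, ← hx]
  obtain ⟨h1, h2⟩ := normDescent hE₀ hy₀' (hN₀ ▸ hNx) (hN₂ ▸ hNx2)
  refine ⟨hx ▸ isSquare_map_of_isSquare e h1, ?_⟩
  have : x + 2 = e (x₀ + 2) := by rw [map_add, map_ofNat, ← hx]
  rw [this]
  exact isSquare_map_of_isSquare e h2

/-- **The norm-`1` `2`-descent of `480a1` over ANY cubic extension `K'/ℚ` generated by a root of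
`f' = X³ + X² - 446X + 248`** (e.g. the corresponding subfield of `ℚ(ζ₁₃₃₉)`).
[cite: DokchitserDokchitser2011RankModN, proof of Thm. 2] -/
theorem normDescent_of_root (h3 : Module.finrank ℚ K' = 3) {θ' : K'}
    (hθ' : θ' ^ 3 + θ' ^ 2 - 446 * θ' + 248 = 0) {x y : K'} (hE : y ^ 2 = x * (x + 2) * (x - 3))
    (hy : y ≠ 0) (hNx : IsSquare (Algebra.norm ℚ x)) (hNx2 : IsSquare (Algebra.norm ℚ (x + 2))) :
    IsSquare x ∧ IsSquare (x + 2) :=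
  normDescent_of_algEquiv (algEquivOfRoot h3 hθ') hE hy hNx hNx2

end Transport

end CyclicCubic1339A

end Literature.NumberTheory.NumberFields

end
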